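import Summits.Ventures.WeilGRH.UniformConductorFloorLog9TableValidA
import Summits.Ventures.WeilGRH.UniformConductorFloorLog9TableValidB
import Summits.Ventures.WeilGRH.UniformConductorFloorLog9TableValidC
import Summits.Ventures.WeilGRH.UniformConductorFloorLog9TableValidD
import Summits.Ventures.WeilGRH.UniformConductorFloorLog9TableValidE
import Summits.Ventures.WeilGRH.UniformConductorFloorLog9TableValidF
import Summits.Ventures.WeilGRH.UniformConductorFloorLog9TableValidG
import Summits.Ventures.WeilGRH.UniformConductorFloorLog9TableValidH
import Summits.Ventures.WeilGRH.UniformConductorFloorLog9TableValidI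
import HarnessLib

/-!
# GRH arm (rh-explicit, venture WeilGRH): the special-value table `Log9Table` — `tab_valid : TabValid (2^80) a ks 160 tab` (glue of the kernel parts)

Cell `rh-explicit`, WEIL TRACK — GRH ARM (weil-grh-1 gen10; glue of the kernel parts A–I, re-cut from gen9's sequential chain so that the
parts after A import only A and file in parallel; slice width 19 at this window).  Part A certifies `P`, `A`, `C`, the prime data and the modes `0 … 19`;
the later parts certify `checkTable` slices; this file chains them with `TabValid.extend` into `tab_valid : TabValid (2^80) a ks 160 tab` — the input of
weil-grh-2's twisted cell kits (doors E/C) and of the table-based Galerkin refutation `UniformConductorFloorGalerkinTab` at this window.  No kernel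
computation here; no definitions; standard axioms. [cite: Moore1966, Ch. 3 (interval arithmetic: inclusion property)]
-/

namespace Summit.Ventures.WeilGRH.Log9Table
open Literature.NumberTheory.LFunctions Literature.NumberTheory.LFunctions.Yoshida1992 Encl Literature.Analysis.ValidatedNumerics.NumericsMP

/-- The table is valid below `39`. [cite: Moore1966, Ch. 3 (interval arithmetic: inclusion property)] -/
theorem tab_valid39 : TabValid (2 ^ 80) a ks (20 + 19) tab :=
  tab_valid20.extend fun n hn hnk ↦ idxValid_of_checkTable (prm := prm) (by norm_num [prm]) a_pos consts_valid tT20 hn hnk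

/-- The table is valid below `58`. [cite: Moore1966, Ch. 3 (interval arithmetic: inclusion property)] -/
theorem tab_valid58 : TabValid (2 ^ 80) a ks (39 + 19) tab :=
  tab_valid39.extend fun n hn hnk ↦ idxValid_of_checkTable (prm := prm) (by norm_num [prm]) a_pos consts_valid tT39 hn hnk

/-- The table is valid below `77`. [cite: Moore1966, Ch. 3 (interval arithmetic: inclusion property)] -/
theorem tab_valid77 : TabValid (2 ^ 80) a ks (58 + 19) tab :=
  tab_valid58.extend fun n hn hnk ↦ idxValid_of_checkTable (prm := prm) (by norm_num [prm]) a_pos consts_valid tT58 hn hnk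

/-- The table is valid below `96`. [cite: Moore1966, Ch. 3 (interval arithmetic: inclusion property)] -/
theorem tab_valid96 : TabValid (2 ^ 80) a ks (77 + 19) tab :=
  tab_valid77.extend fun n hn hnk ↦ idxValid_of_checkTable (prm := prm) (by norm_num [prm]) a_pos consts_valid tT77 hn hnk

/-- The table is valid below `115`. [cite: Moore1966, Ch. 3 (interval arithmetic: inclusion property)] -/
theorem tab_valid115 : TabValid (2 ^ 80) a ks (96 + 19) tab :=
  tab_valid96.extend fun n hn hnk ↦ idxValid_of_checkTable (prm := prm) (by norm_num [prm]) a_pos consts_valid tT96 hn hnk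

/-- The table is valid below `134`. [cite: Moore1966, Ch. 3 (interval arithmetic: inclusion property)] -/
theorem tab_valid134 : TabValid (2 ^ 80) a ks (115 + 19) tab :=
  tab_valid115.extend fun n hn hnk ↦ idxValid_of_checkTable (prm := prm) (by norm_num [prm]) a_pos consts_valid tT115 hn hnk

/-- The table is valid below `153`. [cite: Moore1966, Ch. 3 (interval arithmetic: inclusion property)] -/
theorem tab_valid153 : TabValid (2 ^ 80) a ks (134 + 19) tab :=
  tab_valid134.extend fun n hn hnk ↦ idxValid_of_checkTable (prm := prm) (by norm_num [prm]) a_pos consts_valid tT134 hn hnk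

/-- The table is valid below `160`. [cite: Moore1966, Ch. 3 (interval arithmetic: inclusion property)] -/
theorem tab_valid160 : TabValid (2 ^ 80) a ks (153 + 7) tab :=
  tab_valid153.extend fun n hn hnk ↦ idxValid_of_checkTable (prm := prm) (by norm_num [prm]) a_pos consts_valid tT153 hn hnk


end Summit.Ventures.WeilGRH.Log9Table
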